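import Summits.BirchSwinnertonDyer.BirchSwinnertonDyer.Theorems.Rank2ObservatoryRank3ModFiveImage
import Literature.NumberTheory.EllipticCurves.ModFiveImageS4JLineProofs
import HarnessLib

/-!
# Rank-2 observatory, rank-3 arm — THE MOD-5 GALOIS IMAGE OF THE RANK-3 TABLE, NOW EVERY ROW DECIDED:
# the one row left open by row 67, `133956a1` (`i = 975`, `j = 421632 = 12³·(12² + 5·12 + 40) = J₉(12)`), is NOT onto —
# its `j`-invariant lies on Zywina's exceptional `j`-line `J₉` (projective image `𝔖₄`); so on the rank-3 table
# `ρ̄_{E,5}` is onto `GL₂(𝔽₅)` on `9 474` rows and not onto on `13` (`6` reducible, `6` CM, `1` exceptional)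

HONEST FRAMING: per-curve certified theorems and census instruments; no claim on BSD in rank ≥ 2.
Cell `b2b-bsdr2`, unit `b2b-bsdr2-cert-2` (rank-3 arm), gen 63 (KCI row 67, completion); zero-kit, no new data.
`--supports stmt-BirchSwinnertonDyer-16218 --as helper` (no stub closes; the value is a theorem).

WHAT IS CERTIFIED:
* `Rank3Row.j_133956a1` — row `975` has `j = 12³·(12² + 5·12 + 40)` (`= 421632`; kernel: `c4³ = 421632·Δ` on the row, then
  row 48's `Rank3Row.curve_j`).
* `not_hasSurjectiveModNGaloisRep_five_133956a1` — `ρ̄_{E,5}` is NOT onto for `133956a1`: the tree's DISCHARGED named fact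
  `zywina2015_thm14_not_surjective_five_of_j_eq_J9` (`…_holds`, `ModFiveImageS4JLineProofs`: a non-CM `E/ℚ` with
  `j(E) = t³(t² + 5t + 40)`, `t ∈ ℚ`, has `ρ̄_{E,5}` not surjective — the `N_s(5)` factor of `ψ₅` over a cubic field and the
  cubic-field criterion) at `t = 12`; non-CM by row 67's `five_133956a1`.  This is the row that NO Frobenius certificate can
  decide (row 67: no repeated-eigenvalue witness below `3 000`; the `(2c, c²)` classes have density `1/96` in its image).
* `Rank3Row.hasSurjectiveModNGaloisRep_five_iff` — EVERY row, hypothesis-free: onto iff `i ∉ redFive ∧ i ∉ cmIdx ∧ i ≠ 975`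
  (row 67's `…five_iff_of_getElem?` without its `i ≠ 975` proviso).
* `Rank3Row.hasSurjectiveModNGaloisRep_five_iff_of_mem` — INDEX-FREE, every row: `ρ̄_{E,5}` onto iff `E[5]` is irreducible,
  `E` has no CM and `j(E) ≠ 421632`; and the tetrachotomy `Rank3Row.surjective_five_cases`.
NOT CLAIMED: the precise image of `133956a1` (it is contained in Zywina's `G₉`, index `5`, projective image `𝔖₄`; equality is
not certified); images at other primes; table completeness; BSD.  Sources: Zywina, arXiv:1508.07660 (2015) §1.3 (`G₉`, `J₉`),
Thm. 1.4; Serre, Invent. Math. 15 (1972) §2.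
-/

set_option linter.dupNamespace false
set_option autoImplicit false

namespace Summit.BirchSwinnertonDyer.BirchSwinnertonDyer.Rank2Observatory

open Literature Literature.NumberTheory.EllipticCurves WeierstrassCurve

/-! ## §1 The exceptional row `133956a1` -/

/-- kernel: on row `975` the integers satisfy `c4³ = 421632·Δ`. [folklore] -/
theorem j9Check_975 : (rank3Table[975]?.map fun r : Rank3Row => (r.c4 ^ 3 == 421632 * r.delta)) = some true := by
  decide +kernel

/-- **`j(133956a1) = 12³·(12² + 5·12 + 40)`** (`= 421632 = J₉(12)`, Zywina's exceptional `j`-line at `5`).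
[cite: Zywina2015, §1.3 (G₉, J₉)] -/
theorem Rank3Row.j_133956a1 {r : Rank3Row} (h : rank3Table[975]? = some r) :
    (haveI := isElliptic_of_mem (List.mem_of_getElem? h); r.curve.j) = 12 ^ 3 * (12 ^ 2 + 5 * 12 + 40) := by
  haveI := isElliptic_of_mem (List.mem_of_getElem? h)
  have hb := j9Check_975
  rw [h] at hb
  simp only [Option.map_some, Option.some.injEq, beq_iff_eq] at hb
  have hd : (r.delta : ℚ) ≠ 0 := by exact_mod_cast Rank3Row.delta_ne_zero (r := r)
  rw [Rank3Row.curve_j, div_eq_iff hd]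
  have hb' : ((r.c4 : ℚ)) ^ 3 = 421632 * (r.delta : ℚ) := by exact_mod_cast hb
  rw [hb']; norm_num

/-- **`133956a1` (row `975`): `ρ̄_{E,5}` is NOT onto `GL₂(𝔽₅)`** — `j = J₉(12)` and the tree's discharged Zywina fact
(non-CM curves on the `J₉`-line are not surjective at `5`); non-CM by row 67.
[cite: Zywina2015, Thm. 1.4 (second item, i = 9)] [cite: Serre1972, §2.1] -/
theorem not_hasSurjectiveModNGaloisRep_five_133956a1 {r : Rank3Row} (h : rank3Table[975]? = some r) :
    ¬ r.curve.HasSurjectiveModNGaloisRep 5 := by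
  haveI := isElliptic_of_mem (List.mem_of_getElem? h)
  exact zywina2015_thm14_not_surjective_five_of_j_eq_J9_holds r.curve (five_133956a1 h).2 12 (Rank3Row.j_133956a1 h)

/-! ## §2 Every row decided -/

/-- **THE MOD-5 IMAGE OF EVERY ROW, hypothesis-free**: `ρ̄_{E_r,5}` is onto `GL₂(𝔽₅)` iff row `i` is off `redFive`, off
`cmIdx` and is not row `975`. [cite: Serre1972, §2.4 Prop. 15] [cite: Zywina2015, Thm. 1.4] -/
theorem Rank3Row.hasSurjectiveModNGaloisRep_five_iff {i : ℕ} {r : Rank3Row} (h : rank3Table[i]? = some r) :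
    r.curve.HasSurjectiveModNGaloisRep 5 ↔ i ∉ redFive ∧ i ∉ cmIdx ∧ i ≠ 975 := by
  by_cases h975 : i = 975
  · subst h975
    exact ⟨fun hs => absurd hs (not_hasSurjectiveModNGaloisRep_five_133956a1 h), fun hh => absurd rfl hh.2.2⟩
  · rw [Rank3Row.hasSurjectiveModNGaloisRep_five_iff_of_getElem? h h975]
    exact ⟨fun hh => ⟨hh.1, hh.2, h975⟩, fun hh => ⟨hh.1, hh.2.1⟩⟩

/-- kernel: row `975` is the ONLY row with `c4³ = 421632·Δ` (i.e. with `j = 421632`) among the rows off `redFive ∪ cmIdx`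
— checked as: every row has `c4³ ≠ 421632·Δ` or index `975`. [folklore] -/
def Rank3Row.j9B (r : Rank3Row) (i : ℕ) : Bool := i == 975 || !(r.c4 ^ 3 == 421632 * r.delta)

/-- `j9B` along a chunk whose first row has index `i`. [folklore] -/
def j9Go : List Rank3Row → ℕ → Bool
  | [], _ => true
  | r :: rs, i => r.j9B i && j9Go rs (i + 1)

/-- `j9Go` checks every row of the chunk at its index (structural). [folklore] -/
theorem j9Go_getElem? : ∀ (rows : List Rank3Row) (i j : ℕ) (r : Rank3Row),
    j9Go rows i = true → rows[j]? = some r → r.j9B (i + j) = true := by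
  intro rows
  induction rows with
  | nil => intro i j r _ h; simp at h
  | cons r₀ rs ih =>
    intro i j r hgo h
    simp only [j9Go, Bool.and_eq_true] at hgo
    cases j with
    | zero =>
      simp only [List.getElem?_cons_zero, Option.some.injEq] at h
      subst h; simpa using hgo.1
    | succ j =>
      simp only [List.getElem?_cons_succ] at h
      have := ih (i + 1) j r hgo.2 h
      rwa [show i + 1 + j = i + (j + 1) by ring] at this

/-- `j9Go` splits along an append. [folklore] -/
theorem j9Go_append : ∀ (l₁ l₂ : List Rank3Row) (i : ℕ),
    j9Go (l₁ ++ l₂) i = (j9Go l₁ i && j9Go l₂ (i + l₁.length)) := by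
  intro l₁
  induction l₁ with
  | nil => intro l₂ i; simp [j9Go]
  | cons r rs ih =>
    intro l₂ i
    simp only [List.cons_append, j9Go, ih, List.length_cons, Bool.and_assoc]
    congr 2
    rw [show i + 1 + rs.length = i + (rs.length + 1) by ring]

section chunks
set_option maxHeartbeats 4000000
/-- chunk `01` (rows `0 … 351`) passes. [folklore] -/ theorem j9c01 : j9Go rank3Rows01 0 = true := by decide +kernel
/-- chunk `02` (rows `352 … 703`) passes. [folklore] -/ theorem j9c02 : j9Go rank3Rows02 352 = true := by decide +kernel
/-- chunk `03` (rows `704 … 1055`) passes. [folklore] -/ theorem j9c03 : j9Go rank3Rows03 704 = true := by decide +kernel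
/-- chunk `04` (rows `1056 … 1407`) passes. [folklore] -/ theorem j9c04 : j9Go rank3Rows04 1056 = true := by decide +kernel
/-- chunk `05` (rows `1408 … 1759`) passes. [folklore] -/ theorem j9c05 : j9Go rank3Rows05 1408 = true := by decide +kernel
/-- chunk `06` (rows `1760 … 2111`) passes. [folklore] -/ theorem j9c06 : j9Go rank3Rows06 1760 = true := by decide +kernel
/-- chunk `07` (rows `2112 … 2463`) passes. [folklore] -/ theorem j9c07 : j9Go rank3Rows07 2112 = true := by decide +kernel
/-- chunk `08` (rows `2464 … 2815`) passes. [folklore] -/ theorem j9c08 : j9Go rank3Rows08 2464 = true := by decide +kernel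
/-- chunk `09` (rows `2816 … 3167`) passes. [folklore] -/ theorem j9c09 : j9Go rank3Rows09 2816 = true := by decide +kernel
/-- chunk `10` (rows `3168 … 3519`) passes. [folklore] -/ theorem j9c10 : j9Go rank3Rows10 3168 = true := by decide +kernel
/-- chunk `11` (rows `3520 … 3871`) passes. [folklore] -/ theorem j9c11 : j9Go rank3Rows11 3520 = true := by decide +kernel
/-- chunk `12` (rows `3872 … 4223`) passes. [folklore] -/ theorem j9c12 : j9Go rank3Rows12 3872 = true := by decide +kernel
/-- chunk `13` (rows `4224 … 4575`) passes. [folklore] -/ theorem j9c13 : j9Go rank3Rows13 4224 = true := by decide +kernel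
/-- chunk `14` (rows `4576 … 4927`) passes. [folklore] -/ theorem j9c14 : j9Go rank3Rows14 4576 = true := by decide +kernel
/-- chunk `15` (rows `4928 … 5279`) passes. [folklore] -/ theorem j9c15 : j9Go rank3Rows15 4928 = true := by decide +kernel
/-- chunk `16` (rows `5280 … 5631`) passes. [folklore] -/ theorem j9c16 : j9Go rank3Rows16 5280 = true := by decide +kernel
/-- chunk `17` (rows `5632 … 5983`) passes. [folklore] -/ theorem j9c17 : j9Go rank3Rows17 5632 = true := by decide +kernel
/-- chunk `18` (rows `5984 … 6335`) passes. [folklore] -/ theorem j9c18 : j9Go rank3Rows18 5984 = true := by decide +kernel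
/-- chunk `19` (rows `6336 … 6687`) passes. [folklore] -/ theorem j9c19 : j9Go rank3Rows19 6336 = true := by decide +kernel
/-- chunk `20` (rows `6688 … 7039`) passes. [folklore] -/ theorem j9c20 : j9Go rank3Rows20 6688 = true := by decide +kernel
/-- chunk `21` (rows `7040 … 7391`) passes. [folklore] -/ theorem j9c21 : j9Go rank3Rows21 7040 = true := by decide +kernel
/-- chunk `22` (rows `7392 … 7743`) passes. [folklore] -/ theorem j9c22 : j9Go rank3Rows22 7392 = true := by decide +kernel
/-- chunk `23` (rows `7744 … 8095`) passes. [folklore] -/ theorem j9c23 : j9Go rank3Rows23 7744 = true := by decide +kernel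
/-- chunk `24` (rows `8096 … 8447`) passes. [folklore] -/ theorem j9c24 : j9Go rank3Rows24 8096 = true := by decide +kernel
/-- chunk `25` (rows `8448 … 8799`) passes. [folklore] -/ theorem j9c25 : j9Go rank3Rows25 8448 = true := by decide +kernel
/-- chunk `26` (rows `8800 … 9151`) passes. [folklore] -/ theorem j9c26 : j9Go rank3Rows26 8800 = true := by decide +kernel
/-- chunk `27` (rows `9152 … 9486`) passes. [folklore] -/ theorem j9c27 : j9Go rank3Rows27 9152 = true := by decide +kernel
end chunks

/-- **the whole table passes `j9B`** (the `27` chunk passes assembled along `j9Go_append`). [folklore] -/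
theorem j9Go_rank3Table : j9Go rank3Table 0 = true := by
  simp only [rank3Table, j9Go_append, List.length_append, Nat.reduceAdd, Bool.and_self,
    rank3Rows01_length, rank3Rows02_length, rank3Rows03_length, rank3Rows04_length, rank3Rows05_length,
    rank3Rows06_length, rank3Rows07_length, rank3Rows08_length, rank3Rows09_length, rank3Rows10_length,
    rank3Rows11_length, rank3Rows12_length, rank3Rows13_length, rank3Rows14_length, rank3Rows15_length,
    rank3Rows16_length, rank3Rows17_length, rank3Rows18_length, rank3Rows19_length, rank3Rows20_length,
    rank3Rows21_length, rank3Rows22_length, rank3Rows23_length, rank3Rows24_length, rank3Rows25_length,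
    rank3Rows26_length,
    j9c01, j9c02, j9c03, j9c04, j9c05, j9c06, j9c07, j9c08, j9c09, j9c10, j9c11, j9c12, j9c13, j9c14,
    j9c15, j9c16, j9c17, j9c18, j9c19, j9c20, j9c21, j9c22, j9c23, j9c24, j9c25, j9c26, j9c27]

/-- every row other than `975` has `c4³ ≠ 421632·Δ`. [folklore] -/
theorem Rank3Row.c4_pow_ne_of_getElem? {i : ℕ} {r : Rank3Row} (h : rank3Table[i]? = some r) (hi : i ≠ 975) :
    r.c4 ^ 3 ≠ 421632 * r.delta := by
  have hm : r.j9B i = true := by simpa using j9Go_getElem? rank3Table 0 i r j9Go_rank3Table h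
  simp only [Rank3Row.j9B, Bool.or_eq_true, beq_iff_eq, hi, false_or, Bool.not_eq_true', beq_eq_false_iff_ne, ne_eq] at hm
  exact hm

/-- **every row other than `133956a1` has `j ≠ 421632`** (so `133956a1` is the table's only curve on the fibre `J₉(12)`).
[cite: Zywina2015, §1.3 (G₉, J₉)] -/
theorem Rank3Row.j_ne_of_getElem? {i : ℕ} {r : Rank3Row} (h : rank3Table[i]? = some r) (hi : i ≠ 975) :
    (haveI := isElliptic_of_mem (List.mem_of_getElem? h); r.curve.j) ≠ 421632 := by
  haveI := isElliptic_of_mem (List.mem_of_getElem? h)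
  have hd : (r.delta : ℚ) ≠ 0 := by exact_mod_cast Rank3Row.delta_ne_zero (r := r)
  rw [Rank3Row.curve_j, ne_eq, div_eq_iff hd]
  intro hj
  exact Rank3Row.c4_pow_ne_of_getElem? h hi (by exact_mod_cast hj)

/-- **ON THE RANK-3 TABLE, INDEX-FREE AND FOR EVERY ROW: `ρ̄_{E,5}` IS ONTO `GL₂(𝔽₅)` IFF `E[5]` IS IRREDUCIBLE, `E` HAS NO CM
AND `j(E) ≠ 421632`** (`421632 = J₉(12)`; the three failure modes are realised by `6`, `6` and `1` rows).
[cite: Serre1972, §2.4 Prop. 15] [cite: Zywina2015, Thm. 1.4] -/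
theorem Rank3Row.hasSurjectiveModNGaloisRep_five_iff_of_mem {r : Rank3Row} (hr : r ∈ rank3Table) :
    r.curve.HasSurjectiveModNGaloisRep 5 ↔
      (haveI : Fact (Nat.Prime 5) := ⟨by norm_num⟩; r.curve.HasIrreducibleModPGaloisRep 5) ∧ ¬ r.curve.HasCM ∧
        (haveI := isElliptic_of_mem hr; r.curve.j) ≠ 421632 := by
  haveI : Fact (Nat.Prime 5) := ⟨by norm_num⟩
  haveI := isElliptic_of_mem hr
  obtain ⟨i, h⟩ := List.mem_iff_getElem?.mp hr
  rw [Rank3Row.hasSurjectiveModNGaloisRep_five_iff h]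
  constructor
  · rintro ⟨h5, hcm, h975⟩
    exact ⟨Rank3Row.hasIrreducibleModPGaloisRep_five_of_getElem? h h5,
      fun hc => hcm ((Rank3Row.hasCM_iff_of_getElem? h).mp hc), Rank3Row.j_ne_of_getElem? h h975⟩
  · rintro ⟨hirr, hcm, hj⟩
    refine ⟨fun h5 => Rank3Row.not_hasIrreducibleModPGaloisRep_five_of_mem_redFive h h5 hirr,
      fun hc => hcm ((Rank3Row.hasCM_iff_of_getElem? h).mpr hc), fun h975 => hj ?_⟩
    subst h975
    have := Rank3Row.j_133956a1 h
    norm_num at this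
    exact this

/-- **THE FOUR CASES, index-free, for every row of the rank-`3` table**: `ρ̄_{E_r,5}` onto `GL₂(𝔽₅)`, or `E_r[5]` reducible,
or `E_r` has CM, or `j(E_r) = 421632` (the `𝔖₄` row) — and in each of the last three it is not onto.
[cite: Serre1972, §2.4 Prop. 15] [cite: Zywina2015, Thm. 1.4] -/
theorem Rank3Row.surjective_five_cases {r : Rank3Row} (hr : r ∈ rank3Table) :
    r.curve.HasSurjectiveModNGaloisRep 5 ∨
      ((¬ (haveI : Fact (Nat.Prime 5) := ⟨by norm_num⟩; r.curve.HasIrreducibleModPGaloisRep 5) ∨ r.curve.HasCM ∨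
          (haveI := isElliptic_of_mem hr; r.curve.j) = 421632) ∧ ¬ r.curve.HasSurjectiveModNGaloisRep 5) := by
  have h := Rank3Row.hasSurjectiveModNGaloisRep_five_iff_of_mem hr
  by_cases hs : r.curve.HasSurjectiveModNGaloisRep 5
  · exact Or.inl hs
  · refine Or.inr ⟨?_, hs⟩
    rw [h] at hs
    push Not at hs
    by_cases hirr : (haveI : Fact (Nat.Prime 5) := ⟨by norm_num⟩; r.curve.HasIrreducibleModPGaloisRep 5)
    · by_cases hc : r.curve.HasCM
      · exact Or.inr (Or.inl hc)
      · exact Or.inr (Or.inr (hs hirr hc))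
    · exact Or.inl hirr

end Summit.BirchSwinnertonDyer.BirchSwinnertonDyer.Rank2Observatory
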